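import Literature.NumberTheory.Sieve.HeathBrownCubicFLSequencesA
import Literature.NumberTheory.Sieve.HeathBrownMorozClassFamily
import HarnessLib

/-!
# The class sequence `𝒜_f` as a sifted sequence: (6.1)–(6.2) and the remainders, for a class

Port of `HeathBrownCubicFLSequencesA` (D. R. Heath-Brown, *Primes represented by `x³ + 2y³`*, Acta
Math. 186 (2001), §6 pp. 33–35) to the residue-class subfamily of D. R. Heath-Brown and
B. Z. Moroz, *On the representation of primes by cubic polynomials in two variables*, Proc. LMS 88
(2004), §2–§3: the pairs of the box `(X, X(1+η)]²` with `x ≡ a, y ≡ b (mod d)`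
(`CubicSieve.classPairs`; `#𝒜_R(class) = classCountA`).  It supplies the `𝒜`-side objects of the
Fundamental-Lemma comparison (HBM Lemma 3.1 = [HB, Lemma 3.5] for the class) in the shape the
tree's proof of Lemma 3.5 (`HeathBrownCubicFLAssembly`) consumes them:
* the density `classDensA d` — Heath-Brown's `ρ₀(q)/q` with the primes `p ∣ d` removed (the
  function `Γ` of [HBM, Lemma 2.4], `CubicPrimes.typeIDensity d`), multiplicative, `≤ densA`, of
  sieve dimension `≤ 3` with the same constant `dimConst`;
* the size `classSizeA X η d = (6η²X²/π²)·(ζ(2)/ζ_d(2))·d⁻²` ([HBM, (2.29)]: `η²X²/ζ_d(2)` per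
  unit density of the class);
* the rational sequences `classSeqA X η d a b q = {x³ + 2y³ : (x, y) ∈ class box, coprime,
  q ∣ x³ + 2y³}` as `SieveSequence`s, their sifted sums and congruence sums;
* **(6.1) for the class**, `Tpiece_classPairs_eq`:
  `T^(n)(𝒜_f) = ∑_{t ∈ ratChains n} S((𝒜_f)_{∏t}, X^τ)`, exactly;
* `card_classPairs_dvd_eq_sum_classCountA` (`#(𝒜_f)_r = ∑_{N(R)=r} #𝒜_R(class)`, `r` square-free),
  `sum_normEq_indicator_rho₂_div_eq_classDensA`
  (`∑_{N(R)=r} [(d,N R)=1]ρ₂(R)/N(R) = classDensA d r`), and **`abs_remainder_classSeqA_le`**: the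
  Fundamental-Lemma remainders of `(𝒜_f)_q` are bounded by the class Type-I errors
  `|#𝒜_R(class) − [(d,N R)=1]·classSizeA·ρ₂(R)/N(R)|` of `HeathBrownMorozClassTypeI.class_typeI_A`.
All proofs are those of `HeathBrownCubicFLSequencesA` with `boxPairs` replaced by `classPairs ⊆
boxPairs`; the only new arithmetic is the indicator `[(d, N R) = 1]`, constant on `N(R) = r`.
[cite: HeathBrownMoroz2004, Lemma 2.4 and Lemma 3.1] [cite: HeathBrownActa2001, §6 (6.1)–(6.2)]
Search: `lean search 'seqA|densA|Tpiece_boxPairs_eq|typeIDensity'` — the `d = 1` objects of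
`HeathBrownCubicFLSequencesA` and HBM's `typeIDensity`; no class sequence before this file.
-/

noncomputable section

open NumberField Finset Filter

open scoped Topology

namespace Literature.NumberTheory.Sieve.CubicSieve

open LFunctions.CubeRootTwoField CubicPrimes UniqueFactorizationMonoid

/-! ### The class density `Γ` and the class size -/

/-- **The density of the class sequence**: `ρ₀(p)/p = ν_p/(p+1)` at the primes `p ∤ d` and `0` at
`p ∣ d` (no member of an admissible class is divisible by a prime dividing `d`), as a
multiplicative arithmetic function — the function `Γ` of [HBM, Lemma 2.4].
[cite: HeathBrownMoroz2004, Lemma 2.4] -/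
def classDensA (d : ℕ) : ArithmeticFunction ℝ :=
  ArithmeticFunction.prodPrimeFactors fun p => if p ∣ d then 0 else rho₀ p / p

/-- `classDensA d` is multiplicative. [cite: HeathBrownMoroz2004, Lemma 2.4] -/
theorem isMultiplicative_classDensA (d : ℕ) : (classDensA d).IsMultiplicative :=
  ArithmeticFunction.IsMultiplicative.prodPrimeFactors _

/-- `classDensA d q = ∏_{p ∣ q} (p ∣ d ? 0 : ρ₀(p)/p)` for `q ≠ 0`.
[cite: HeathBrownMoroz2004, Lemma 2.4] -/
theorem classDensA_apply (d : ℕ) {q : ℕ} (hq : q ≠ 0) :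
    classDensA d q = ∏ p ∈ q.primeFactors, if p ∣ d then 0 else rho₀ p / p := by
  rw [classDensA, ArithmeticFunction.prodPrimeFactors_apply hq]

/-- `classDensA d = Γ` of [HBM]: `classDensA d q = typeIDensity d q` for `q ≠ 0`.
[cite: HeathBrownMoroz2004, Lemma 2.4] -/
theorem classDensA_eq_typeIDensity (d : ℕ) {q : ℕ} (hq : q ≠ 0) :
    classDensA d q = typeIDensity d q := by
  rw [classDensA_apply d hq, typeIDensity_def]
  refine prod_congr rfl fun p hp => ?_
  split_ifs
  · rfl
  · rw [rho₀_div_eq (Nat.prime_of_mem_primeFactors hp).pos]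

/-- `0 ≤ classDensA d q ≤ densA q`. [cite: HeathBrownMoroz2004, Lemma 2.4] -/
theorem classDensA_nonneg_and_le (d q : ℕ) : 0 ≤ classDensA d q ∧ classDensA d q ≤ densA q := by
  rcases eq_or_ne q 0 with rfl | hq
  · simp [classDensA, densA]
  rw [classDensA_apply d hq, densA_apply hq]
  have h0 : ∀ p ∈ q.primeFactors, 0 ≤ (if p ∣ d then 0 else rho₀ p / p) := fun p _ => by
    split_ifs
    · exact le_rfl
    · exact div_nonneg (rho₀_nonneg p) (Nat.cast_nonneg p)
  refine ⟨prod_nonneg h0, prod_le_prod h0 fun p _ => ?_⟩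
  split_ifs
  · exact div_nonneg (rho₀_nonneg p) (Nat.cast_nonneg p)
  · exact le_rfl

/-- `classDensA d r = [(d, r) = 1]·densA r` for `r ≠ 0`. [cite: HeathBrownMoroz2004, Lemma 2.4] -/
theorem classDensA_eq_ite (d : ℕ) {r : ℕ} (hr : r ≠ 0) :
    classDensA d r = if Nat.Coprime d r then densA r else 0 := by
  rw [classDensA_apply d hr, densA_apply hr]
  split_ifs with hcop
  · refine prod_congr rfl fun p hp => ?_
    have hpr : p ∣ r := Nat.dvd_of_mem_primeFactors hp
    rw [if_neg fun hpd => (Nat.prime_of_mem_primeFactors hp).ne_one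
      (Nat.eq_one_of_dvd_coprimes hcop hpd hpr)]
  · obtain ⟨p, hp, hpd, hpr⟩ := Nat.Prime.not_coprime_iff_dvd.mp hcop
    exact prod_eq_zero ((Nat.mem_primeFactors_of_ne_zero hr).mpr ⟨hp, hpr⟩) (if_pos hpd)

/-- **The class density has sieve dimension `≤ 3`** with the constant `dimConst` of `densA`
(`0 ≤ classDensA ≤ densA ≤ 3/p, 1/2` at primes). [cite: HeathBrownMoroz2004, Lemma 2.4] -/
theorem hasSieveDimension_classDensA (d : ℕ) : HasSieveDimension (classDensA d) 3 dimConst := by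
  have h := hasSieveDimension_of_le_div (g := classDensA d) (A := 3) (δ := 1 / 2) (by norm_num)
    (fun p hp => ?_)
  · simpa [dimConst] using h
  obtain ⟨h0, hle⟩ := classDensA_nonneg_and_le d p
  rw [densA_prime hp] at hle
  have hp2 : (2 : ℝ) ≤ p := by exact_mod_cast hp.two_le
  have hν : (cubeRootTwoCount p : ℝ) ≤ 3 := by exact_mod_cast cubeRootTwoCount_le_three hp
  refine ⟨h0, hle.trans ?_, hle.trans ?_⟩
  · rw [div_le_div_iff₀ (by linarith) (by linarith)]
    push_cast
    nlinarith
  · -- `ν_p/(p+1) ≤ 1/2`: for `p ≥ 5` from `ν_p ≤ 3`, for `p = 2, 3` from `ν_2 = ν_3 = 1`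
    by_cases hp5 : 5 ≤ p
    · have hp5' : (5 : ℝ) ≤ p := by exact_mod_cast hp5
      rw [div_le_iff₀ (by linarith)]
      linarith
    · have hp23 : p = 2 ∨ p = 3 := by
        have := hp.two_le
        interval_cases p
        · exact Or.inl rfl
        · exact Or.inr rfl
        · exact absurd hp (by decide)
      rcases hp23 with rfl | rfl
      · rw [cubeRootTwoCount_two]; norm_num
      · rw [cubeRootTwoCount_three]; norm_num

/-- **The size of the class sequence**: `X_{𝒜_f} = (6η²X²/π²)·(ζ(2)/ζ_d(2))·d⁻²` — the class has
density `d⁻²` among all pairs and the proportion of coprime pairs in it is `1/ζ_d(2)`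
([HBM, (2.29)] with `6/π² = 1/ζ(2)`). [cite: HeathBrownMoroz2004, Lemma 2.4 (2.29)] -/
def classSizeA (X η : ℝ) (d : ℕ) : ℝ :=
  6 * η ^ 2 * X ^ 2 / Real.pi ^ 2 * zetaTwoCorrection d / (d : ℝ) ^ 2

/-- `classSizeA X η d = sizeA X η · zetaTwoCorrection d / d²`.
[cite: HeathBrownMoroz2004, Lemma 2.4 (2.29)] -/
theorem classSizeA_eq (X η : ℝ) (d : ℕ) :
    classSizeA X η d = sizeA X η * zetaTwoCorrection d / (d : ℝ) ^ 2 := by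
  rw [classSizeA, sizeA]

/-- `X_{𝒜_f} ≥ 0`. [cite: HeathBrownMoroz2004, Lemma 2.4 (2.29)] -/
theorem classSizeA_nonneg (X η : ℝ) (d : ℕ) : 0 ≤ classSizeA X η d := by
  rw [classSizeA]
  have := zetaTwoCorrection_pos d
  positivity

/-! ### The rational class sequences `(𝒜_f)_q` -/

/-- **The rational class sequence `(𝒜_f)_q` as a sifted sequence**: the multiset
`{x³ + 2y³ : x, y ∈ (X, X(1+η)], x ≡ a, y ≡ b (mod d), gcd(x, y) = 1, q ∣ x³ + 2y³}`, with expected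
size `X_{𝒜_f}·Γ(q)` and density `Γ` (the class analogue of `seqA`, [HB, p. 34]).
[cite: HeathBrownMoroz2004, Lemma 2.4] [cite: HeathBrownActa2001, §6 p. 34] -/
def classSeqA (X η : ℝ) (d a b q : ℕ) : SieveSequence where
  a k := (#{xy ∈ classPairs X η d a b | xy.1 ^ 3 + 2 * xy.2 ^ 3 = k ∧ q ∣ k} : ℝ)
  a_nonneg _ := Nat.cast_nonneg _
  size _ := classSizeA X η d * classDensA d q
  density := classDensA d
  density_mult := isMultiplicative_classDensA d

/-- Sums of `(𝒜_f)_q` over a set of integers count pairs of the class: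
`∑_{k ≤ 3(X(1+η))³, c(k)} a_k = #{(x, y) ∈ class box : q ∣ x³ + 2y³, c(x³ + 2y³)}`.
[cite: HeathBrownActa2001, §6 p. 34] -/
theorem sum_classSeqA_a_filter {X η : ℝ} (hX : 0 ≤ X) (d a b q : ℕ) (c : ℕ → Prop)
    [DecidablePred c] :
    ∑ k ∈ (Ioc 0 ⌊topA X η⌋₊).filter c, (classSeqA X η d a b q).a k =
      #{xy ∈ classPairs X η d a b | q ∣ xy.1 ^ 3 + 2 * xy.2 ^ 3 ∧ c (xy.1 ^ 3 + 2 * xy.2 ^ 3)} := by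
  classical
  have hmaps : Set.MapsTo (fun xy : ℕ × ℕ => xy.1 ^ 3 + 2 * xy.2 ^ 3)
      ({xy ∈ classPairs X η d a b | q ∣ xy.1 ^ 3 + 2 * xy.2 ^ 3 ∧
        c (xy.1 ^ 3 + 2 * xy.2 ^ 3)} : Finset (ℕ × ℕ))
      ((Ioc 0 ⌊topA X η⌋₊).filter c) := by
    intro xy hxy
    rw [mem_coe, mem_filter] at hxy ⊢
    exact ⟨norm_mem_Ioc_of_mem_boxPairs hX (classPairs_subset_boxPairs X η d a b hxy.1), hxy.2.2⟩
  rw [card_eq_sum_card_fiberwise hmaps, Nat.cast_sum]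
  refine sum_congr rfl fun k hk => ?_
  simp only [classSeqA, filter_filter]
  congr 2
  ext xy
  simp only [mem_filter, and_congr_right_iff]
  intro _
  constructor
  · rintro ⟨rfl, h2⟩; exact ⟨⟨h2, (mem_filter.mp hk).2⟩, rfl⟩
  · rintro ⟨⟨h1, -⟩, rfl⟩; exact ⟨rfl, h1⟩

/-- `S((𝒜_f)_q, z)` counts the pairs of the class with `q ∣ x³ + 2y³` and `(x³ + 2y³, P(z)) = 1`.
[cite: HeathBrownActa2001, §6 p. 34] -/
theorem sifted_classSeqA_eq {X η : ℝ} (hX : 0 ≤ X) (d a b q : ℕ) (z : ℝ) :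
    (classSeqA X η d a b q).sifted (topA X η) (primesProdBelow z) =
      #{xy ∈ classPairs X η d a b | q ∣ xy.1 ^ 3 + 2 * xy.2 ^ 3 ∧
        (xy.1 ^ 3 + 2 * xy.2 ^ 3).Coprime (primesProdBelow z)} := by
  rw [SieveSequence.sifted, sum_classSeqA_a_filter hX]

/-- `((𝒜_f)_q)_e` counts the pairs of the class with `q ∣ x³ + 2y³` and `e ∣ x³ + 2y³`.
[cite: HeathBrownActa2001, §6 p. 34] -/
theorem congrSum_classSeqA_eq {X η : ℝ} (hX : 0 ≤ X) (d a b q e : ℕ) :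
    (classSeqA X η d a b q).congrSum e (topA X η) =
      #{xy ∈ classPairs X η d a b | q ∣ xy.1 ^ 3 + 2 * xy.2 ^ 3 ∧ e ∣ xy.1 ^ 3 + 2 * xy.2 ^ 3} := by
  rw [SieveSequence.congrSum, sum_classSeqA_a_filter hX]

open scoped Classical in
/-- **(6.1) for the class**: `T^(n)(𝒜_f) = ∑_{t ∈ ratChains n} S((𝒜_f)_{∏t}, X^τ)`, exactly, for
every `X ≥ 0`, `η`, `τ`, `n` — the proof of `Tpiece_boxPairs_eq` on the subfamily (Lemma 3.1:
`NormSimple.card_chains_dvd_eq`, `NormSimple.isRough_iff_coprime`).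
[cite: HeathBrownMoroz2004, Lemma 3.1] [cite: HeathBrownActa2001, §6 (6.1)–(6.2)] -/
theorem Tpiece_classPairs_eq {X : ℝ} (hX : 0 ≤ X) (η τ : ℝ) (d a b n : ℕ) :
    (Tpiece (classPairs X η d a b) pairIdeal X τ n : ℝ) =
      ∑ t ∈ ratChains X τ n,
        (classSeqA X η d a b (∏ p ∈ t, p)).sifted (topA X η) (primesProdBelow (X ^ τ)) := by
  simp only [sifted_classSeqA_eq hX, Tpiece, famSifted]
  rw [← Nat.cast_sum, Nat.cast_inj, sum_card_filter_comm, sum_card_filter_comm (ratChains X τ n)]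
  refine sum_congr rfl fun xy hxy' => ?_
  have hxy : xy ∈ boxPairs X η := classPairs_subset_boxPairs X η d a b hxy'
  have h0 : pairIdeal xy ≠ ⊥ := pairIdeal_ne_bot_of_mem_boxPairs hX xy hxy
  have hI : NormSimple (pairIdeal xy) := normSimple_pairIdeal (isCoprime_of_mem_boxPairs hxy)
  rw [← absNorm_pairIdeal]
  by_cases hr : IsRough (X ^ τ) (pairIdeal xy)
  · have hc := (hI.isRough_iff_coprime h0 (X ^ τ)).mp hr
    rw [filter_congr (q := fun s => ∏ P ∈ s, P ∣ pairIdeal xy) fun s _ => and_iff_left hr,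
      filter_congr (q := fun t => ∏ p ∈ t, p ∣ Ideal.absNorm (pairIdeal xy))
        fun t _ => and_iff_left hc]
    exact hI.card_chains_dvd_eq h0 X τ n
  · have hc : ¬ (Ideal.absNorm (pairIdeal xy)).Coprime (primesProdBelow (X ^ τ)) :=
      fun h => hr ((hI.isRough_iff_coprime h0 (X ^ τ)).mpr h)
    rw [filter_false_of_mem fun s _ h => hr h.2, filter_false_of_mem fun t _ h => hc h.2,
      card_empty, card_empty]

/-! ### `#(𝒜_f)_r` through `#𝒜_R(class)`, and `Γ(r)` through `[(d,N R)=1]ρ₂(R)/N(R)` -/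

/-- **`∑_{N(R) = r} [(d, N R) = 1]·ρ₂(R)/N(R) = Γ(r) = classDensA d r` for square-free `r`**
(`sum_normEq_rho₂_div_eq_densA` and `classDensA d r = [(d,r)=1]·densA r`).
[cite: HeathBrownMoroz2004, Lemma 2.4] [cite: HeathBrownActa2001, §5 p. 33] -/
theorem sum_normEq_indicator_rho₂_div_eq_classDensA (d : ℕ) {r : ℕ} (hr : Squarefree r) :
    ∑ R ∈ normEq r, (if Nat.Coprime d (Ideal.absNorm R) then rho₂ R / Ideal.absNorm R else 0) =
      classDensA d r := by
  have hval : ∀ R ∈ normEq r,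
      (if Nat.Coprime d (Ideal.absNorm R) then rho₂ R / Ideal.absNorm R else 0) =
        if Nat.Coprime d r then rho₂ R / Ideal.absNorm R else 0 := by
    intro R hR
    rw [mem_normEq] at hR
    rw [hR]
  rw [sum_congr rfl hval, classDensA_eq_ite d hr.ne_zero]
  split_ifs
  · exact sum_normEq_rho₂_div_eq_densA hr
  · exact sum_const_zero

open scoped Classical in
/-- **`#(𝒜_f)_r = ∑_{N(R) = r} #𝒜_R(class)` for square-free `r`**: a pair with `r ∣ x³ + 2y³` is
divisible by exactly one ideal of norm `r` (the proof of `card_boxPairs_dvd_eq_sum_countA` on the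
class). [cite: HeathBrownMoroz2004, Lemma 3.1] [cite: HeathBrownActa2001, §5 p. 33] -/
theorem card_classPairs_dvd_eq_sum_classCountA {X : ℝ} (hX : 0 ≤ X) (η : ℝ) (d a b : ℕ) {r : ℕ}
    (hr : Squarefree r) :
    (#{xy ∈ classPairs X η d a b | r ∣ xy.1 ^ 3 + 2 * xy.2 ^ 3} : ℝ) =
      ∑ R ∈ normEq r, (classCountA X η d a b R : ℝ) := by
  rw [← Nat.cast_sum, Nat.cast_inj]
  simp only [classCountA, classAPairs]
  rw [sum_card_filter_comm (normEq r) (classPairs X η d a b) fun R xy => R ∣ pairIdeal xy,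
    card_eq_sum_ones, sum_filter]
  refine sum_congr rfl fun xy hxy' => ?_
  have hxy : xy ∈ boxPairs X η := classPairs_subset_boxPairs X η d a b hxy'
  have h0 : pairIdeal xy ≠ ⊥ := pairIdeal_ne_bot_of_mem_boxPairs hX xy hxy
  have hI : NormSimple (pairIdeal xy) := normSimple_pairIdeal (isCoprime_of_mem_boxPairs hxy)
  rw [← absNorm_pairIdeal]
  split_ifs with hdvd
  · -- exactly one ideal of norm `r` divides `(x + yθ)`
    set R₀ := ∏ P ∈ (primeFactorsFinset (pairIdeal xy)).filter
      (fun P => Ideal.absNorm P ∣ r), P with hR₀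
    have hsub : (primeFactorsFinset (pairIdeal xy)).filter (fun P => Ideal.absNorm P ∣ r) ⊆
        primeFactorsFinset (pairIdeal xy) := filter_subset _ _
    have hR₀dvd : R₀ ∣ pairIdeal xy := by
      refine prod_dvd_of_forall_prime_dvd fun P hP => ?_
      have hPF := hsub hP
      obtain ⟨hPp, hPI⟩ := (mem_primeFactorsFinset_iff h0).mp hPF
      exact ⟨hPp, ne_bot_of_mem_primeFactorsFinset h0 hPF, hPI⟩
    have hR₀N : Ideal.absNorm R₀ = r := by
      rw [hR₀, hI.absNorm_prod_eq h0 hsub]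
      have himg : ((primeFactorsFinset (pairIdeal xy)).filter
          (fun P => Ideal.absNorm P ∣ r)).image (fun P => Ideal.absNorm P) = r.primeFactors := by
        ext p
        simp only [mem_image, mem_filter, mem_primeFactorsFinset_iff h0, Nat.mem_primeFactors,
          ne_eq]
        constructor
        · rintro ⟨P, ⟨⟨hPp, hPI⟩, hPr⟩, rfl⟩
          exact ⟨(hI.prime_absNorm_and_dvd h0 hPp hPI).1, hPr, hr.ne_zero⟩
        · rintro ⟨hp, hpr, -⟩
          obtain ⟨P, hP, -, hPI, hNP⟩ := hI.exists_prime_dvd_of_dvd_absNorm h0 hp (hpr.trans hdvd)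
          exact ⟨P, ⟨⟨hP, hPI⟩, hNP ▸ hpr⟩, hNP⟩
      rw [himg, Nat.prod_primeFactors_of_squarefree hr]
    rw [eq_comm, card_eq_one]
    refine ⟨R₀, ?_⟩
    ext R
    simp only [mem_filter, mem_normEq, mem_singleton]
    constructor
    · rintro ⟨hRN, hRI⟩
      rw [hI.eq_prod_filter_of_dvd h0 hRI (hRN ▸ hr), hRN]
    · rintro rfl
      exact ⟨hR₀N, hR₀dvd⟩
  · rw [eq_comm, card_eq_zero, filter_eq_empty_iff]
    intro R hR hRI
    rw [mem_normEq] at hR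
    exact hdvd (hR ▸ Ideal.absNorm_dvd_absNorm_of_le (Ideal.dvd_iff_le.mp hRI))

open scoped Classical in
/-- **The remainders of `(𝒜_f)_q` are bounded by the class Type-I errors.** For square-free `qe`:
`|R_e((𝒜_f)_q)| = |#(𝒜_f)_{qe} − X_{𝒜_f}Γ(qe)|
   ≤ ∑_{N(R)=qe} |#𝒜_R(class) − [(d,N R)=1]X_{𝒜_f}ρ₂(R)/N(R)|`
(the class analogue of `abs_remainder_seqA_le`, [HB, p. 35]; the summands are those of
`class_typeI_A`). [cite: HeathBrownMoroz2004, Lemma 2.3] [cite: HeathBrownActa2001, §6 p. 35] -/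
theorem abs_remainder_classSeqA_le {X : ℝ} (hX : 0 ≤ X) (η : ℝ) (d a b : ℕ) {q e : ℕ}
    (hqe : Squarefree (q * e)) :
    |(classSeqA X η d a b q).remainder e (topA X η)| ≤
      ∑ R ∈ normEq (q * e), |(classCountA X η d a b R : ℝ) -
        (if Nat.Coprime d (Ideal.absNorm R) then
          classSizeA X η d * rho₂ R / Ideal.absNorm R else 0)| := by
  have hcop : q.Coprime e := Nat.coprime_of_squarefree_mul hqe
  have hcongr : (classSeqA X η d a b q).congrSum e (topA X η) =
      #{xy ∈ classPairs X η d a b | q * e ∣ xy.1 ^ 3 + 2 * xy.2 ^ 3} := by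
    rw [congrSum_classSeqA_eq hX]
    congr 2
    exact filter_congr fun xy _ =>
      ⟨fun h => hcop.mul_dvd_of_dvd_of_dvd h.1 h.2,
        fun h => ⟨dvd_of_mul_right_dvd h, dvd_of_mul_left_dvd h⟩⟩
  have hite : ∀ R : Ideal (𝓞 K), (if Nat.Coprime d (Ideal.absNorm R) then
      classSizeA X η d * rho₂ R / Ideal.absNorm R else 0) =
      classSizeA X η d *
        (if Nat.Coprime d (Ideal.absNorm R) then rho₂ R / Ideal.absNorm R else 0) := fun R => by
    split_ifs
    · exact mul_div_assoc _ _ _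
    · exact (mul_zero _).symm
  have hrem : (classSeqA X η d a b q).remainder e (topA X η) =
      ∑ R ∈ normEq (q * e), ((classCountA X η d a b R : ℝ) -
        (if Nat.Coprime d (Ideal.absNorm R) then
          classSizeA X η d * rho₂ R / Ideal.absNorm R else 0)) := by
    rw [SieveSequence.remainder, hcongr, card_classPairs_dvd_eq_sum_classCountA hX η d a b hqe,
      sum_sub_distrib]
    congr 1
    change classDensA d e * (classSizeA X η d * classDensA d q) = _
    simp_rw [hite]
    rw [← mul_sum, sum_normEq_indicator_rho₂_div_eq_classDensA d hqe,
      (isMultiplicative_classDensA d).map_mul_of_coprime hcop]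
    ring
  rw [hrem]
  exact abs_sum_le_sum_abs _ _

end Literature.NumberTheory.Sieve.CubicSieve

end
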